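import Mathlib
import Summits.NavierStokesRegularity.NavierStokesRegularity.Theorems.EulerZoomLiouvillePowerGaugeEulerLiouvillePressureSlavingBreather
import Summits.NavierStokesRegularity.NavierStokesRegularity.Theorems.EulerZoomLiouvillePowerGaugeEulerLiouvilleSelfSimilarPressureSlaving
import Summits.NavierStokesRegularity.NavierStokesRegularity.Theorems.EulerZoomLiouvillePowerGaugeEulerLiouvillePressureSwap
import Summits.NavierStokesRegularity.NavierStokesRegularity.Theorems.EulerZoomLiouvillePowerGaugeEulerLiouvilleSelfSimilarPressureSlavingPastProfile
import HarnessLib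

/-!
# Crux E `PowerGaugeEulerLiouville` (stmt-NavierStokesRegularity-19832): BREATHER PRESSURE SLAVING — the pressure of a log-time breather velocity is
# (a.e.) the breather ansatz of a profile
# (lane «pressure slaving», log-time group; consumers: the weak breather residue of line `logtime-breathers` / `IsTameBreather`; width seat ns-ezl-w3 g2)

Route `EulerZoomLiouville` (NavierStokesRegularity), crux E.  A LOG-TIME BREATHER velocity `u τ y = e^{cτ} V(e^{−cτ} y)` (`τ < 0`) is fixed by the
one-parameter family of past-pointing Euler symmetries `(s, y) ↦ (s + h, e^{ch} y)` with amplitude `e^{−ch}`, `h ≤ 0`, so its class pressure is invariant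
a.e. under the same family (`PressureSlaving.breather_pressure_ae_invariant`, `…PressureSlavingBreather`).  This file extracts the profile:

* `PressureSlaving.ae_Iio_of_ae_Iio_add` — transport of a.e. statements along `h ↦ s + h`;
* `PressureSlaving.exists_breatherProfile_of_shiftInvariant` — **ADDITIVE ONE-SIDED EXTRACTION**: `p` a.e.-strongly measurable on `(−∞, S) × ℝ³` and
  `p(s, y) = e^{−2ch} p(s + h, e^{ch} y)` a.e. for every `h ≤ 0` ⇒ there is a measurable `Q` with `p(s, y) = e^{2cs} Q(e^{−cs} y)` for a.e. `y`, for
  a.e. `s < S` (profile read at time `s`: `Φ(s, x) = e^{−2cs} p(s, e^{cs} x)`; Fubini in `(h, s, x)`; good times `σ_n → −∞` — the additive twin of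
  `…SelfSimilarPressureSlavingPastProfile`);
* `PressureSlaving.inClass_breatherPressure` — **MEMBER FORM**: crux binders verbatim (`ρ > −1/2`) + `∀ τ < 0, ∀ y, u τ y = e^{cτ} • V (e^{−cτ} • y)`
  (ANY real `c`, any `V`) ⇒ there are a measurable `Q` and a pressure `p'` with `p' = p` a.e. on the slab, `InClass ρ u p' H c` (ns-ezl-w2's
  `PressureSwap.inClass_congr_pressure_ae`) and the EXACT breather pressure clause `∀ τ < 0, ∀ y, p' τ y = (e^{cτ})² Q(e^{−cτ} y)`.

WHAT THIS IS NOT: not NS regularity, not the crux E — a de-conditioning lemma for (future) breather strata of the crux CLASS 19832 on the MODEL lattice;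
`--supports` stmt-19832. [folklore; RusinSverak2011 §2 p. 4; CaffarelliKohnNirenberg1982 §2]
-/

noncomputable section

-- flat `Theorems/<Route><Decl>…` files of one crux share the namespace of the crux (tree convention: `Summit.<S>.<S>.…`)
set_option linter.dupNamespace false

open MeasureTheory Set Filter Topology Metric Function TopologicalSpace
open scoped ENNReal NNReal

namespace Summit.NavierStokesRegularity.NavierStokesRegularity.Theorems.PowerGaugeEulerLiouville

open Literature.Analysis Literature.Analysis.FunctionSpaces Literature.Analysis.FluidPDE

namespace PressureSlaving

/-- **Transport along `h ↦ s + h`.**  If `P (s + h)` holds for a.e. `h < 0`, then `P σ` holds for a.e. `σ < s` (translation preserves Lebesgue measure).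
[folklore] -/
theorem ae_Iio_of_ae_Iio_add {s : ℝ} {P : ℝ → Prop}
    (h : ∀ᵐ η ∂(volume.restrict (Iio (0 : ℝ))), P (s + η)) :
    ∀ᵐ σ ∂(volume.restrict (Iio s)), P σ := by
  have h' : ∀ᵐ η ∂(volume : Measure ℝ), η ∈ Iio (0 : ℝ) → P (s + η) := (ae_restrict_iff' measurableSet_Iio).1 h
  have hq := (measurePreserving_sub_right (volume : Measure ℝ) s).quasiMeasurePreserving
  refine (ae_restrict_iff' measurableSet_Iio).2 ?_
  filter_upwards [hq.ae h'] with σ hσ hσs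
  have hmem : σ - s ∈ Iio (0 : ℝ) := by rw [mem_Iio]; exact sub_neg.2 hσs
  have := hσ hmem
  rwa [add_sub_cancel] at this

/-- **ADDITIVE ONE-SIDED EXTRACTION (breather pressure profiles).**  Let `p` be a.e.-strongly measurable on the slab `(−∞, S) × ℝ³` and suppose that
for every `h ≤ 0`, `p(s, y) = (e^{−ch})² p(s + h, e^{ch} y)` for a.e. `(s, y)` in the slab.  Then there is a measurable `Q : ℝ³ → ℝ` with
`p(s, y) = (e^{cs})² Q(e^{−cs} y)` for a.e. `y`, for a.e. `s < S`. [folklore] -/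
theorem exists_breatherProfile_of_shiftInvariant {c S : ℝ} {p : ℝ → EuclideanSpace ℝ (Fin 3) → ℝ}
    (hpm : AEStronglyMeasurable (uncurry p)
      (volume.restrict (Iio S ×ˢ (univ : Set (EuclideanSpace ℝ (Fin 3))))))
    (hinv : ∀ h : ℝ, h ≤ 0 → ∀ᵐ z ∂(volume.restrict (Iio S ×ˢ (univ : Set (EuclideanSpace ℝ (Fin 3))))),
      p z.1 z.2 = Real.exp (-(c * h)) ^ 2 * p (z.1 + h) (Real.exp (c * h) • z.2)) :
    ∃ Q : EuclideanSpace ℝ (Fin 3) → ℝ, Measurable Q ∧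
      ∀ᵐ s ∂(volume.restrict (Iio S)),
        p s =ᵐ[volume] fun y => Real.exp (c * s) ^ 2 * Q (Real.exp (-(c * s)) • y) := by
  -- ### notation and the strongly measurable modification
  set Sl : Set (ℝ × EuclideanSpace ℝ (Fin 3)) := Iio S ×ˢ (univ : Set (EuclideanSpace ℝ (Fin 3))) with hSl
  have hSlm : MeasurableSet Sl := measurableSet_Iio.prod MeasurableSet.univ
  set μT : Measure ℝ := (volume : Measure ℝ).restrict (Iio S) with hμT
  set μ : Measure (ℝ × EuclideanSpace ℝ (Fin 3)) := μT.prod (volume : Measure (EuclideanSpace ℝ (Fin 3))) with hμ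
  have hμS : (volume : Measure (ℝ × EuclideanSpace ℝ (Fin 3))).restrict Sl = μ := volume_restrict_slab_eq_prod_top S
  set pt : ℝ × EuclideanSpace ℝ (Fin 3) → ℝ := hpm.mk (uncurry p) with hpt
  have hptm : Measurable pt := hpm.stronglyMeasurable_mk.measurable
  have hppt : ∀ᵐ z ∂(volume.restrict Sl), uncurry p z = pt z := hpm.ae_eq_mk
  have hppt' : ∀ᵐ z ∂(volume : Measure (ℝ × EuclideanSpace ℝ (Fin 3))), z ∈ Sl → uncurry p z = pt z :=
    (ae_restrict_iff' hSlm).1 hppt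
  -- ### invariance of the modification (`h ≤ 0` maps the slab into itself)
  have hinvt : ∀ h : ℝ, h ≤ 0 → ∀ᵐ z ∂μ, pt z = Real.exp (-(c * h)) ^ 2 * pt (z.1 + h, Real.exp (c * h) • z.2) := by
    intro h hh
    have hq : Measure.QuasiMeasurePreserving
        (fun z : ℝ × EuclideanSpace ℝ (Fin 3) => (z.1 + h, Real.exp (c * h) • z.2)) volume volume := by
      have h1 := MeasureTheory.QuasiMeasurePreserving.prodMap
        (measurePreserving_add_right (volume : Measure ℝ) h).quasiMeasurePreserving
        (Measure.quasiMeasurePreserving_smul (volume : Measure (EuclideanSpace ℝ (Fin 3))) (Real.exp_pos (c * h)).ne')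
      rw [← Measure.volume_eq_prod] at h1
      exact h1
    have h2 : ∀ᵐ z ∂(volume : Measure (ℝ × EuclideanSpace ℝ (Fin 3))),
        (z.1 + h, Real.exp (c * h) • z.2) ∈ Sl → uncurry p (z.1 + h, Real.exp (c * h) • z.2) = pt (z.1 + h, Real.exp (c * h) • z.2) :=
      hq.ae hppt'
    rw [← hμS]
    refine (ae_restrict_iff' hSlm).2 ?_
    filter_upwards [hppt', h2, (ae_restrict_iff' hSlm).1 (hinv h hh)] with z h1 h2 h3 hz
    have hz1 : z.1 < S := hz.1
    have hz' : (z.1 + h, Real.exp (c * h) • z.2) ∈ Sl := mem_prod.2 ⟨by show z.1 + h < S; linarith, mem_univ _⟩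
    have e1 : pt z = p z.1 z.2 := by rw [← h1 hz]; rfl
    have e2 : pt (z.1 + h, Real.exp (c * h) • z.2) = p (z.1 + h) (Real.exp (c * h) • z.2) := by rw [← h2 hz']; rfl
    rw [e1, e2]
    exact h3 hz
  -- ### the profile read off at time `s`
  set Φ : ℝ → EuclideanSpace ℝ (Fin 3) → ℝ := fun s x => Real.exp (-(2 * c * s)) * pt (s, Real.exp (c * s) • x) with hΦ
  have hΦm : Measurable fun q : ℝ × EuclideanSpace ℝ (Fin 3) => Φ q.1 q.2 := by
    refine (Real.measurable_exp.comp (measurable_fst.const_mul (2 * c)).neg).mul (hptm.comp ?_)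
    exact measurable_fst.prodMk ((Real.measurable_exp.comp (measurable_fst.const_mul c)).smul measurable_snd)
  have hT : ∀ᵐ s ∂μT, s < S := ae_restrict_mem measurableSet_Iio
  have hΦinv : ∀ h : ℝ, h ≤ 0 → ∀ᵐ s ∂μT, ∀ᵐ x ∂(volume : Measure (EuclideanSpace ℝ (Fin 3))), Φ (s + h) x = Φ s x := by
    intro h hh
    have h1 := Measure.ae_ae_of_ae_prod (hinvt h hh)
    filter_upwards [h1] with s hs
    have hc : Real.exp (c * s) ≠ 0 := (Real.exp_pos _).ne'
    have h2 := (Measure.quasiMeasurePreserving_smul (volume : Measure (EuclideanSpace ℝ (Fin 3))) hc).ae hs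
    filter_upwards [h2] with x hx
    -- `hx : pt (s, e^{cs} • x) = (e^{-ch})² * pt (s + h, e^{ch} • e^{cs} • x)`
    simp only [hΦ]
    rw [hx, smul_smul, ← Real.exp_add, show c * h + c * s = c * (s + h) by ring]
    rw [show Real.exp (-(2 * c * s)) * (Real.exp (-(c * h)) ^ 2 * pt (s + h, Real.exp (c * (s + h)) • x)) =
      (Real.exp (-(2 * c * s)) * Real.exp (-(c * h)) ^ 2) * pt (s + h, Real.exp (c * (s + h)) • x) by ring]
    congr 1
    rw [sq, ← Real.exp_add, ← Real.exp_add]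
    congr 1
    ring
  -- ### Fubini in `(h, s, x)`: for a.e. `(s, x)`, `Φ σ x = Φ s x` for a.e. `σ < s`
  have hM : MeasurableSet {q : ℝ × (ℝ × EuclideanSpace ℝ (Fin 3)) | Φ (q.2.1 + q.1) q.2.2 = Φ q.2.1 q.2.2} :=
    measurableSet_eq_fun
      (hΦm.comp ((measurable_snd.fst.add measurable_fst).prodMk measurable_snd.snd))
      (hΦm.comp measurable_snd)
  have hMh : ∀ h : ℝ, MeasurableSet {w : ℝ × EuclideanSpace ℝ (Fin 3) | Φ (w.1 + h) w.2 = Φ w.1 w.2} := fun h =>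
    measurableSet_eq_fun (hΦm.comp ((measurable_fst.add_const h).prodMk measurable_snd)) hΦm
  have h3 : ∀ᵐ h ∂((volume : Measure ℝ).restrict (Iio 0)), ∀ᵐ w ∂μ, Φ (w.1 + h) w.2 = Φ w.1 w.2 := by
    refine (ae_restrict_iff' measurableSet_Iio).2 (ae_of_all _ fun h hh => ?_)
    exact (Measure.ae_prod_iff_ae_ae (hMh h)).2 (hΦinv h (le_of_lt hh))
  have h4 : ∀ᵐ w ∂μ, ∀ᵐ h ∂((volume : Measure ℝ).restrict (Iio 0)), Φ (w.1 + h) w.2 = Φ w.1 w.2 :=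
    (Measure.ae_ae_comm (μ := (volume : Measure ℝ).restrict (Iio 0)) (ν := μ)
      (p := fun h w => Φ (w.1 + h) w.2 = Φ w.1 w.2) hM).1 h3
  have hw1 : ∀ᵐ w ∂μ, w.1 < S := by
    rw [← hμS]
    filter_upwards [ae_restrict_mem hSlm] with w hw
    exact hw.1
  have h5 : ∀ᵐ w ∂μ, ∀ᵐ σ ∂(volume : Measure ℝ), σ < w.1 → Φ σ w.2 = Φ w.1 w.2 := by
    filter_upwards [h4] with w hw
    exact (ae_restrict_iff' measurableSet_Iio).1 (ae_Iio_of_ae_Iio_add (P := fun σ => Φ σ w.2 = Φ w.1 w.2) hw)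
  -- ### Fubini once more: a.e. `σ` is good
  have hG : MeasurableSet {q : ℝ × (ℝ × EuclideanSpace ℝ (Fin 3)) | q.1 < q.2.1 → Φ q.1 q.2.2 = Φ q.2.1 q.2.2} := by
    have e : {q : ℝ × (ℝ × EuclideanSpace ℝ (Fin 3)) | q.1 < q.2.1 → Φ q.1 q.2.2 = Φ q.2.1 q.2.2} =
        {q : ℝ × (ℝ × EuclideanSpace ℝ (Fin 3)) | q.1 < q.2.1}ᶜ ∪
          {q : ℝ × (ℝ × EuclideanSpace ℝ (Fin 3)) | Φ q.1 q.2.2 = Φ q.2.1 q.2.2} := by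
      ext q
      simp only [mem_setOf_eq, mem_union, mem_compl_iff, imp_iff_not_or]
    rw [e]
    exact (measurableSet_lt measurable_fst measurable_snd.fst).compl.union
      (measurableSet_eq_fun (hΦm.comp (measurable_fst.prodMk measurable_snd.snd)) (hΦm.comp measurable_snd))
  have h6 : ∀ᵐ σ ∂(volume : Measure ℝ), ∀ᵐ w ∂μ, σ < w.1 → Φ σ w.2 = Φ w.1 w.2 :=
    (Measure.ae_ae_comm (μ := μ) (ν := (volume : Measure ℝ))
      (p := fun w σ => σ < w.1 → Φ σ w.2 = Φ w.1 w.2) (by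
        have e : {x : (ℝ × EuclideanSpace ℝ (Fin 3)) × ℝ | x.2 < x.1.1 → Φ x.2 x.1.2 = Φ x.1.1 x.1.2} =
            Prod.swap ⁻¹' {q : ℝ × (ℝ × EuclideanSpace ℝ (Fin 3)) | q.1 < q.2.1 → Φ q.1 q.2.2 = Φ q.2.1 q.2.2} := by
          ext x; simp only [mem_setOf_eq, mem_preimage, Prod.fst_swap, Prod.snd_swap]
        rw [e]; exact measurable_swap hG)).1 h5
  -- ### two good times agree a.e. on `ℝ³`
  have hagree : ∀ σ σ' : ℝ, σ < S → σ' < S →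
      (∀ᵐ w ∂μ, σ < w.1 → Φ σ w.2 = Φ w.1 w.2) → (∀ᵐ w ∂μ, σ' < w.1 → Φ σ' w.2 = Φ w.1 w.2) →
      ∀ᵐ x ∂(volume : Measure (EuclideanSpace ℝ (Fin 3))), Φ σ x = Φ σ' x := by
    intro σ σ' hσ hσ' hgood hgood'
    set σm : ℝ := max σ σ' with hσm
    have hσmS : σm < S := max_lt hσ hσ'
    have h1 : ∀ᵐ w ∂μ, σm < w.1 → Φ σ w.2 = Φ σ' w.2 := by
      filter_upwards [hgood, hgood'] with w hw hw' hlt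
      rw [hw ((le_max_left _ _).trans_lt hlt), hw' ((le_max_right _ _).trans_lt hlt)]
    have h2 : ∀ᵐ s ∂μT, ∀ᵐ x ∂(volume : Measure (EuclideanSpace ℝ (Fin 3))), σm < s → Φ σ x = Φ σ' x :=
      Measure.ae_ae_of_ae_prod (p := fun w : ℝ × EuclideanSpace ℝ (Fin 3) => σm < w.1 → Φ σ w.2 = Φ σ' w.2) h1
    have h3 : ∀ᵐ s ∂(μT.restrict (Ioi σm)), ∀ᵐ x ∂(volume : Measure (EuclideanSpace ℝ (Fin 3))), Φ σ x = Φ σ' x := by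
      filter_upwards [ae_restrict_of_ae h2, ae_restrict_mem measurableSet_Ioi] with s hs hsm
      filter_upwards [hs] with x hx
      exact hx hsm
    have hne : μT.restrict (Ioi σm) ≠ 0 := by
      rw [hμT, Measure.restrict_restrict measurableSet_Ioi, Ne, Measure.restrict_eq_zero]
      have e : Ioi σm ∩ Iio S = Ioo σm S := by ext t; simp [and_comm]
      rw [e, Real.volume_Ioo, ENNReal.ofReal_eq_zero, not_le]
      linarith
    haveI : (ae (μT.restrict (Ioi σm))).NeBot := ae_neBot.2 hne
    obtain ⟨s, hs⟩ := h3.exists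
    exact hs
  -- ### a sequence of good times `σ_n → −∞`
  have hex : ∀ n : ℕ, ∃ σ : ℝ, σ ∈ Ioo (S - n - 2) (S - n - 1) ∧
      ∀ᵐ w ∂μ, σ < w.1 → Φ σ w.2 = Φ w.1 w.2 := by
    intro n
    have h1 : ∀ᵐ σ ∂((volume : Measure ℝ).restrict (Ioo (S - n - 2) (S - n - 1))),
        σ ∈ Ioo (S - n - 2) (S - n - 1) ∧ ∀ᵐ w ∂μ, σ < w.1 → Φ σ w.2 = Φ w.1 w.2 := by
      filter_upwards [ae_restrict_mem measurableSet_Ioo, ae_restrict_of_ae h6] with σ h1 h2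
      exact ⟨h1, h2⟩
    have hne : (volume : Measure ℝ).restrict (Ioo (S - n - 2) (S - n - 1)) ≠ 0 := by
      rw [Ne, Measure.restrict_eq_zero, Real.volume_Ioo, ENNReal.ofReal_eq_zero, not_le]
      linarith
    haveI : (ae ((volume : Measure ℝ).restrict (Ioo (S - n - 2) (S - n - 1)))).NeBot := ae_neBot.2 hne
    exact h1.exists
  choose σs hσs using hex
  have hσS : ∀ n, σs n < S := fun n => by
    have := (hσs n).1.2
    have hn : (0 : ℝ) ≤ n := n.cast_nonneg
    linarith
  refine ⟨fun x => Φ (σs 0) x, hΦm.comp (measurable_const.prodMk measurable_id), ?_⟩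
  have hQn : ∀ n : ℕ, ∀ᵐ x ∂(volume : Measure (EuclideanSpace ℝ (Fin 3))), Φ (σs n) x = Φ (σs 0) x := fun n =>
    hagree (σs n) (σs 0) (hσS n) (hσS 0) (hσs n).2 (hσs 0).2
  have hall : ∀ᵐ w ∂μ, ∀ n : ℕ, (σs n < w.1 → Φ (σs n) w.2 = Φ w.1 w.2) ∧ Φ (σs n) w.2 = Φ (σs 0) w.2 := by
    refine ae_all_iff.2 fun n => ?_
    filter_upwards [(hσs n).2,
      (Measure.quasiMeasurePreserving_snd (μ := μT) (ν := (volume : Measure (EuclideanSpace ℝ (Fin 3))))).ae (hQn n)]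
      with w h1 h2
    exact ⟨h1, h2⟩
  have hΦQ : ∀ᵐ w ∂μ, Φ w.1 w.2 = Φ (σs 0) w.2 := by
    filter_upwards [hall, hw1] with w hw hwS
    obtain ⟨n, hn⟩ := exists_nat_ge (S - 1 - w.1)
    have hlt : σs n < w.1 := by
      have := (hσs n).1.2
      linarith
    rw [← (hw n).1 hlt, (hw n).2]
  -- ### back to `p`
  have h7 : ∀ᵐ s ∂μT, ∀ᵐ x ∂(volume : Measure (EuclideanSpace ℝ (Fin 3))), Φ s x = Φ (σs 0) x :=
    Measure.ae_ae_of_ae_prod (p := fun w : ℝ × EuclideanSpace ℝ (Fin 3) => Φ w.1 w.2 = Φ (σs 0) w.2) hΦQ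
  have h8 : ∀ᵐ s ∂μT, ∀ᵐ y ∂(volume : Measure (EuclideanSpace ℝ (Fin 3))), uncurry p (s, y) = pt (s, y) := by
    have h := hppt
    rw [hμS] at h
    exact Measure.ae_ae_of_ae_prod h
  filter_upwards [h7, h8] with s h7s h8s
  have hc : Real.exp (-(c * s)) ≠ 0 := (Real.exp_pos _).ne'
  have h9 := (Measure.quasiMeasurePreserving_smul (volume : Measure (EuclideanSpace ℝ (Fin 3))) hc).ae h7s
  filter_upwards [h9, h8s] with y hy hpy
  -- `hy : Φ s (e^{-cs} • y) = Q (e^{-cs} • y)`, `hpy : p s y = pt (s, y)`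
  have hcancel : Real.exp (c * s) • Real.exp (-(c * s)) • y = y := by
    rw [smul_smul, ← Real.exp_add, add_neg_cancel, Real.exp_zero, one_smul]
  have hy' : Real.exp (-(2 * c * s)) * pt (s, y) = Φ (σs 0) (Real.exp (-(c * s)) • y) := by
    rw [← hy]
    simp only [hΦ]
    rw [hcancel]
  have hpy' : p s y = pt (s, y) := hpy
  have hA : Real.exp (-(2 * c * s)) ≠ 0 := (Real.exp_pos _).ne'
  rw [hpy', (eq_inv_mul_iff_mul_eq₀ hA).2 hy', ← Real.exp_neg, neg_neg, sq, ← Real.exp_add]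
  congr 1
  ring_nf

/-! ### The member form -/

/-- **BREATHER PRESSURE SLAVING, MEMBER FORM.**  Crux binders verbatim (`InClass ρ u p H c` unfolded; any `ρ > −1/2`) + the velocity is a LOG-TIME BREATHER
on the slab, `u τ y = e^{cτ} • V (e^{−cτ} • y)` for `τ < 0` (ANY real `c`, any `V`) ⇒ there are a measurable profile `Q` and a pressure `p'` with `p' = p`
a.e. on the slab, `(u, p', H)` in the class with the SAME constant (ns-ezl-w2 g2's `PressureSwap.inClass_congr_pressure_ae`), and the EXACT breather pressure
clause `∀ τ < 0, ∀ y, p' τ y = (e^{cτ})² Q(e^{−cτ} y)`.  So a breather stratum never needs a pressure clause. [folklore; RusinSverak2011 §2 p. 4] -/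
theorem inClass_breatherPressure {ρ c : ℝ} (hρ : -1 / 2 < ρ)
    {u : ℝ → EuclideanSpace ℝ (Fin 3) → EuclideanSpace ℝ (Fin 3)} {p : ℝ → EuclideanSpace ℝ (Fin 3) → ℝ}
    {H : ℝ → EuclideanSpace ℝ (Fin 3) → EuclideanSpace ℝ (Fin 3) →L[ℝ] EuclideanSpace ℝ (Fin 3)} {c₀ : ℝ≥0}
    {V : EuclideanSpace ℝ (Fin 3) → EuclideanSpace ℝ (Fin 3)}
    (hcls : IsSuitableWeakSolutionOn (slab (EuclideanSpace ℝ (Fin 3)) (Iio 0) isOpen_Iio) 0 0 u p ∧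
      HasWeakSpatialGradientOn (slab (EuclideanSpace ℝ (Fin 3)) (Iio 0) isOpen_Iio) u H ∧
      (∀ a : ℝ, 0 < a →
        ENNReal.ofReal (a ^ (2 * ρ)) * cknA a (0 : ℝ × EuclideanSpace ℝ (Fin 3)) u +
              ENNReal.ofReal (a ^ ρ) * cknE a (0 : ℝ × EuclideanSpace ℝ (Fin 3)) H +
            ENNReal.ofReal (a ^ (2 * ρ)) * cknD a (0 : ℝ × EuclideanSpace ℝ (Fin 3)) p ≤ (c₀ : ℝ≥0∞)))
    (hu : ∀ τ : ℝ, τ < 0 → ∀ y : EuclideanSpace ℝ (Fin 3), u τ y = Real.exp (c * τ) • V (Real.exp (-(c * τ)) • y)) :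
    ∃ (Q : EuclideanSpace ℝ (Fin 3) → ℝ) (p' : ℝ → EuclideanSpace ℝ (Fin 3) → ℝ), Measurable Q ∧
      (∀ τ : ℝ, τ < 0 → ∀ y : EuclideanSpace ℝ (Fin 3), p' τ y = Real.exp (c * τ) ^ 2 * Q (Real.exp (-(c * τ)) • y)) ∧
      (uncurry p' =ᵐ[volume.restrict (Iio (0 : ℝ) ×ˢ (univ : Set (EuclideanSpace ℝ (Fin 3))))] uncurry p) ∧
      (IsSuitableWeakSolutionOn (slab (EuclideanSpace ℝ (Fin 3)) (Iio 0) isOpen_Iio) 0 0 u p' ∧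
        HasWeakSpatialGradientOn (slab (EuclideanSpace ℝ (Fin 3)) (Iio 0) isOpen_Iio) u H ∧
        (∀ a : ℝ, 0 < a →
          ENNReal.ofReal (a ^ (2 * ρ)) * cknA a (0 : ℝ × EuclideanSpace ℝ (Fin 3)) u +
                ENNReal.ofReal (a ^ ρ) * cknE a (0 : ℝ × EuclideanSpace ℝ (Fin 3)) H +
              ENNReal.ofReal (a ^ (2 * ρ)) * cknD a (0 : ℝ × EuclideanSpace ℝ (Fin 3)) p' ≤ (c₀ : ℝ≥0∞))) := by
  obtain ⟨hsw, hH, hc⟩ := hcls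
  have hcD : ∀ a : ℝ, 0 < a →
      ENNReal.ofReal (a ^ (2 * ρ)) * cknD a (0 : ℝ × EuclideanSpace ℝ (Fin 3)) p ≤ (c₀ : ℝ≥0∞) :=
    fun a ha => le_trans le_add_self (hc a ha)
  have hD : ∀ a : ℝ, 1 ≤ a →
      ∫⁻ z in parabolicCylinder a (0 : ℝ × EuclideanSpace ℝ (Fin 3)), ‖p z.1 z.2‖ₑ ^ (3 / 2 : ℝ) ≤
        (c₀ : ℝ≥0∞) * ENNReal.ofReal (a ^ (2 - 2 * ρ)) :=
    fun a ha => lintegral_cylinder_le_of_gaugeD hcD (one_pos.trans_le ha)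
  have hpm : AEStronglyMeasurable (uncurry p) (volume.restrict (Iio (0 : ℝ) ×ˢ (univ : Set (EuclideanSpace ℝ (Fin 3))))) := by
    have h := hsw.distributional.2.2.1.aestronglyMeasurable; rwa [coe_slab] at h
  have hinv : ∀ h : ℝ, h ≤ 0 → ∀ᵐ z ∂(volume.restrict (Iio (0 : ℝ) ×ˢ (univ : Set (EuclideanSpace ℝ (Fin 3))))),
      p z.1 z.2 = Real.exp (-(c * h)) ^ 2 * p (z.1 + h) (Real.exp (c * h) • z.2) := fun h hh =>
    breather_pressure_ae_invariant hh hsw.distributional ENNReal.coe_ne_top (m := 2 - 2 * ρ) (by linarith) hD hu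
  obtain ⟨Q, hQm, hQ⟩ := exists_breatherProfile_of_shiftInvariant (S := 0) hpm hinv
  set p' : ℝ → EuclideanSpace ℝ (Fin 3) → ℝ := fun τ y =>
    if τ < 0 then Real.exp (c * τ) ^ 2 * Q (Real.exp (-(c * τ)) • y) else p τ y with hp'
  -- `p' = p` a.e. on the slab (slices to slab)
  have hP'm : AEStronglyMeasurable (uncurry p') (volume.restrict (Iio (0 : ℝ) ×ˢ (univ : Set (EuclideanSpace ℝ (Fin 3))))) := by
    have hanz : Measurable fun z : ℝ × EuclideanSpace ℝ (Fin 3) => Real.exp (c * z.1) ^ 2 * Q (Real.exp (-(c * z.1)) • z.2) :=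
      ((Real.measurable_exp.comp (measurable_fst.const_mul c)).pow_const 2).mul
        (hQm.comp ((Real.measurable_exp.comp (measurable_fst.const_mul c).neg).smul measurable_snd))
    refine (hanz.aestronglyMeasurable.congr ?_)
    filter_upwards [ae_restrict_mem (measurableSet_Iio.prod MeasurableSet.univ)] with z hz
    have hz1 : z.1 < 0 := hz.1
    show Real.exp (c * z.1) ^ 2 * Q (Real.exp (-(c * z.1)) • z.2) = p' z.1 z.2
    simp only [hp', if_pos hz1]
  have hslice : ∀ᵐ τ ∂(volume.restrict (Iio (0 : ℝ))), p' τ =ᵐ[volume] p τ := by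
    filter_upwards [hQ, ae_restrict_mem measurableSet_Iio] with τ hτ hτ0
    filter_upwards [hτ] with y hy
    have hτ0' : τ < 0 := hτ0
    simp only [hp', if_pos hτ0']
    exact hy.symm
  have hpp : uncurry p' =ᵐ[volume.restrict (Iio (0 : ℝ) ×ˢ (univ : Set (EuclideanSpace ℝ (Fin 3))))] uncurry p := by
    have h := ae_slab_of_ae_slices hP'm hpm hslice
    filter_upwards [h] with z hz
    exact hz
  refine ⟨Q, p', hQm, fun τ hτ y => ?_, hpp, PressureSwap.inClass_congr_pressure_ae ⟨hsw, hH, hc⟩ hpp⟩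
  simp only [hp', if_pos hτ]

end PressureSlaving

end Summit.NavierStokesRegularity.NavierStokesRegularity.Theorems.PowerGaugeEulerLiouville

end
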